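import Summits.BirchSwinnertonDyer.BirchSwinnertonDyer.Theorems.UniversalToricDescentInvariantsTransportNormProfileFrames
import Summits.BirchSwinnertonDyer.BirchSwinnertonDyer.Theorems.UniversalToricDescentAcDualMuZeroCriterion
import HarnessLib

/-!
# Route UniversalToricDescent — norm-profile algebra in `R₀⟦T⟧` for the Σ-depleted congruence of act D's ♭T:
# profiles add under products, are stable mod `𝔪`, a left factor of a profiled product is profiled, and
# `ord_T(F mod p)` in `Λ` is the profile of `F` read in `R₀⟦T⟧`

Lead prover bsd-wall-utd-p1 g12 (`--supports stmt-BirchSwinnertonDyer-26042`; the `E`-free half of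
`UniversalToricDescentDefectTransportOfSigmaCongruence`). The route reads `μ = 0, λ = n` of an element `Q` of
`R₀⟦T⟧` (`R₀ = 𝒪` of the completed maximal unramified extension of `ℚ_p`, inside `ℂ_p`) as the NORM PROFILE
«`‖[T^i]Q‖ < 1` for `i < n` and `‖[T^n]Q‖ = 1`» (= `ord_T(Q mod 𝔪) = n`). For the analytic half of ♭T
(Greenberg–Vatsal (1.5) / display (9): `λ(L^Σ) = λ(L) + Σ_v λ(𝒫_v)`, and a congruence `L^Σ_E ≡ u·L^Σ_{E′}`
`(mod 𝔪)` preserves `μ = 0` and `λ`) one needs exactly: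

* `normProfile_mul` — profiles ADD under multiplication (`ord_T` is additive on the domain `k⟦T⟧`; here by
  the ultrametric inequality on the Cauchy product);
* `normProfile_of_forall_norm_sub_lt` — a coefficientwise congruence mod `𝔪_{R₀}` preserves the profile;
* `exists_normProfile_left_of_mul` — if `P` has profile `d` and `Q·P` has profile `M` then `Q` has a profile
  `n` with `n + d = M` (so `μ(Q) = 0` is FORCED);
* `normProfile_map_toUnr_of_order_eq` — for `F ∈ Λ = ℤ_p⟦T⟧` with `ord_T(F mod p) = D`, `F` read in `R₀⟦T⟧`
  has profile `D` (`ℤ_p → R₀` is isometric).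

THEOREMS ONLY; no definition, no named fact, no `sorry`. BSD is not advanced by this file.
References: [Washington1997] §7.1 (μ, λ of power series over 𝒪; associates); [GreenbergVatsal2000] §1 display (9).
-/

set_option autoImplicit false
-- `…BirchSwinnertonDyer.BirchSwinnertonDyer.Theorems…` is the problem's mandated namespace (D-0017).
set_option linter.dupNamespace false

noncomputable section

open scoped Classical

namespace Summit.BirchSwinnertonDyer.BirchSwinnertonDyer.Theorems.UniversalToricDescentNormProfile

open Literature.NumberTheory.EllipticCurves PowerSeries Summit.BirchSwinnertonDyer.Rank1Residual.X11b

variable {p : ℕ} [Fact p.Prime]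

/-- A `p`-adic integer is a unit iff its reduction mod `p` is non-zero. [folklore] -/
private theorem isUnit_iff_toZMod_ne_zero' (x : ℤ_[p]) : IsUnit x ↔ PadicInt.toZMod x ≠ 0 := by
  rw [Ne, ← RingHom.mem_ker, PadicInt.ker_toZMod, IsLocalRing.mem_maximalIdeal, mem_nonunits_iff,
    not_not]

/-- **Norm profiles add under multiplication**: if `Q` has its first unit coefficient in degree `n` and `P` in
degree `d` (all lower coefficients of norm `< 1`), then `Q·P` has its first unit coefficient in degree `n + d`
(`R₀⟦T⟧ → k⟦T⟧` is a ring map to a domain: `ord_T(Q̄·P̄) = ord_T Q̄ + ord_T P̄`; here via the ultrametric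
inequality on the Cauchy product). [cite: Washington1997, §7.1 (μ and λ of a product)] -/
theorem normProfile_mul {Q P : UnrSeries p} {n d : ℕ}
    (hQ : (∀ i < n, ‖((PowerSeries.coeff i Q : unrIntegers p) : ℂ_[p])‖ < 1) ∧
      ‖((PowerSeries.coeff n Q : unrIntegers p) : ℂ_[p])‖ = 1)
    (hP : (∀ i < d, ‖((PowerSeries.coeff i P : unrIntegers p) : ℂ_[p])‖ < 1) ∧
      ‖((PowerSeries.coeff d P : unrIntegers p) : ℂ_[p])‖ = 1) :
    (∀ i < n + d, ‖((PowerSeries.coeff i (Q * P) : unrIntegers p) : ℂ_[p])‖ < 1) ∧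
      ‖((PowerSeries.coeff (n + d) (Q * P) : unrIntegers p) : ℂ_[p])‖ = 1 := by
  let F : ℕ × ℕ → ℂ_[p] := fun jk ↦
    ((PowerSeries.coeff jk.1 Q * PowerSeries.coeff jk.2 P : unrIntegers p) : ℂ_[p])
  have hcoe : ∀ i, ((PowerSeries.coeff i (Q * P) : unrIntegers p) : ℂ_[p]) =
      ∑ jk ∈ Finset.HasAntidiagonal.antidiagonal i, F jk := fun i ↦ by
    rw [PowerSeries.coeff_mul]
    exact map_sum (unrIntegers p).subtype _ _
  -- a term `Q_j P_k` with `j < n` or `k < d` has norm `< 1`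
  have hsmall : ∀ jk : ℕ × ℕ, jk.1 < n ∨ jk.2 < d → ‖F jk‖ < 1 := by
    rintro ⟨j, k⟩ hjk
    simp only [F, Subring.coe_mul, norm_mul]
    rcases hjk with hj | hk
    · calc ‖((PowerSeries.coeff j Q : unrIntegers p) : ℂ_[p])‖ *
            ‖((PowerSeries.coeff k P : unrIntegers p) : ℂ_[p])‖
          ≤ ‖((PowerSeries.coeff j Q : unrIntegers p) : ℂ_[p])‖ * 1 :=
            mul_le_mul_of_nonneg_left (norm_coeff_le_one P _) (norm_nonneg _)
        _ < 1 := by rw [mul_one]; exact hQ.1 j hj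
    · calc ‖((PowerSeries.coeff j Q : unrIntegers p) : ℂ_[p])‖ *
            ‖((PowerSeries.coeff k P : unrIntegers p) : ℂ_[p])‖
          ≤ 1 * ‖((PowerSeries.coeff k P : unrIntegers p) : ℂ_[p])‖ :=
            mul_le_mul_of_nonneg_right (norm_coeff_le_one Q _) (norm_nonneg _)
        _ < 1 := by rw [one_mul]; exact hP.1 k hk
  refine ⟨fun i hi ↦ ?_, ?_⟩
  · rw [hcoe i]
    have hne : (Finset.HasAntidiagonal.antidiagonal i).Nonempty := ⟨(0, i), by simp⟩
    obtain ⟨jk, hjk, hle⟩ := IsUltrametricDist.exists_norm_finsetSum_le_of_nonempty hne F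
    refine lt_of_le_of_lt hle (hsmall jk ?_)
    rw [Finset.HasAntidiagonal.mem_antidiagonal] at hjk
    by_contra h
    push Not at h
    omega
  · have hmem : ((n, d) : ℕ × ℕ) ∈ Finset.HasAntidiagonal.antidiagonal (n + d) := by simp
    rw [hcoe (n + d), ← Finset.add_sum_erase _ _ hmem]
    have hlead : ‖F (n, d)‖ = 1 := by
      simp only [F, Subring.coe_mul, norm_mul]
      rw [hQ.2, hP.2, one_mul]
    have hrest : ‖∑ jk ∈ (Finset.HasAntidiagonal.antidiagonal (n + d)).erase (n, d), F jk‖ < 1 := by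
      rcases ((Finset.HasAntidiagonal.antidiagonal (n + d)).erase (n, d)).eq_empty_or_nonempty with h0 | hne
      · rw [h0, Finset.sum_empty, norm_zero]; exact zero_lt_one
      · obtain ⟨jk, hjk, hle⟩ := IsUltrametricDist.exists_norm_finsetSum_le_of_nonempty hne F
        refine lt_of_le_of_lt hle (hsmall jk ?_)
        rw [Finset.mem_erase, Finset.HasAntidiagonal.mem_antidiagonal] at hjk
        by_contra h
        push Not at h
        exact hjk.1 (Prod.ext (by simp; omega) (by simp; omega))
    rw [IsUltrametricDist.norm_add_eq_max_of_norm_ne_norm (by rw [hlead]; exact hrest.ne'), hlead,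
      max_eq_left hrest.le]

/-- **A congruence `mod 𝔪_{R₀}` preserves the norm profile**: if every coefficient of `A − B` has norm `< 1`
and `B` has norm profile `n`, then so has `A` (ultrametric: `‖a‖ = ‖b‖` when `‖a − b‖ < ‖b‖ = 1`).
[cite: Washington1997, §7.1 (μ, λ depend only on the reduction mod 𝔪)] -/
theorem normProfile_of_forall_norm_sub_lt {A B : UnrSeries p} {n : ℕ}
    (hAB : ∀ i, ‖((PowerSeries.coeff i (A - B) : unrIntegers p) : ℂ_[p])‖ < 1)
    (hB : (∀ i < n, ‖((PowerSeries.coeff i B : unrIntegers p) : ℂ_[p])‖ < 1) ∧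
      ‖((PowerSeries.coeff n B : unrIntegers p) : ℂ_[p])‖ = 1) :
    (∀ i < n, ‖((PowerSeries.coeff i A : unrIntegers p) : ℂ_[p])‖ < 1) ∧
      ‖((PowerSeries.coeff n A : unrIntegers p) : ℂ_[p])‖ = 1 := by
  have hsplit : ∀ i, ((PowerSeries.coeff i A : unrIntegers p) : ℂ_[p]) =
      ((PowerSeries.coeff i B : unrIntegers p) : ℂ_[p]) +
        ((PowerSeries.coeff i (A - B) : unrIntegers p) : ℂ_[p]) := fun i ↦ by
    rw [map_sub, AddSubgroupClass.coe_sub]; ring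
  refine ⟨fun i hi ↦ ?_, ?_⟩
  · rw [hsplit i]
    exact lt_of_le_of_lt (IsUltrametricDist.norm_add_le_max _ _) (max_lt (hB.1 i hi) (hAB i))
  · rw [hsplit n, IsUltrametricDist.norm_add_eq_max_of_norm_ne_norm (by rw [hB.2]; exact (hAB n).ne'),
      hB.2, max_eq_left (hAB n).le]

/-- **Left factor of a product with a norm profile**: if `P` has norm profile `d` and `Q·P` has norm profile
`M`, then `Q` has a norm profile `n` with `n + d = M` (in particular `μ(Q) = 0` and `d ≤ M`).
[cite: Washington1997, §7.1 (μ and λ of a product)] -/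
theorem exists_normProfile_left_of_mul {Q P : UnrSeries p} {d M : ℕ}
    (hP : (∀ i < d, ‖((PowerSeries.coeff i P : unrIntegers p) : ℂ_[p])‖ < 1) ∧
      ‖((PowerSeries.coeff d P : unrIntegers p) : ℂ_[p])‖ = 1)
    (hQP : (∀ i < M, ‖((PowerSeries.coeff i (Q * P) : unrIntegers p) : ℂ_[p])‖ < 1) ∧
      ‖((PowerSeries.coeff M (Q * P) : unrIntegers p) : ℂ_[p])‖ = 1) :
    ∃ n : ℕ, ((∀ i < n, ‖((PowerSeries.coeff i Q : unrIntegers p) : ℂ_[p])‖ < 1) ∧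
      ‖((PowerSeries.coeff n Q : unrIntegers p) : ℂ_[p])‖ = 1) ∧ n + d = M := by
  -- `Q` has some coefficient of norm `1`: otherwise every term of `[T^M](Q·P)` is small
  have hex : ∃ i, ‖((PowerSeries.coeff i Q : unrIntegers p) : ℂ_[p])‖ = 1 := by
    by_contra hnone
    push Not at hnone
    have hlt : ∀ i, ‖((PowerSeries.coeff i Q : unrIntegers p) : ℂ_[p])‖ < 1 :=
      fun i ↦ lt_of_le_of_ne (norm_coeff_le_one Q i) (hnone i)
    have h := norm_coeff_mul_lt_one_of_lt P (n := M + 1) (Q := Q) (fun i _ ↦ hlt i) M (Nat.lt_succ_self M)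
    rw [mul_comm] at h
    exact absurd hQP.2 (ne_of_lt h)
  classical
  -- the least index of a unit coefficient of `Q` is a norm profile of `Q`
  have hn : (∀ i < Nat.find hex, ‖((PowerSeries.coeff i Q : unrIntegers p) : ℂ_[p])‖ < 1) ∧
      ‖((PowerSeries.coeff (Nat.find hex) Q : unrIntegers p) : ℂ_[p])‖ = 1 :=
    ⟨fun i hi ↦ lt_of_le_of_ne (norm_coeff_le_one Q i) (Nat.find_min hex hi), Nat.find_spec hex⟩
  refine ⟨Nat.find hex, hn, ?_⟩
  -- norm profiles are unique: compare the profiles `n + d` and `M` of `Q·P`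
  have hQP' := normProfile_mul hn hP
  by_contra hne
  rcases Nat.lt_or_gt_of_ne hne with h | h
  · exact absurd hQP'.2 (ne_of_lt (hQP.1 _ h))
  · exact absurd hQP.2 (ne_of_lt (hQP'.1 _ h))

/-- **From `Λ = ℤ_p⟦T⟧` to `R₀⟦T⟧`: `T`-order mod `p` is the norm profile.** If `F ∈ Λ` has `ord_T(F mod p) = D`
(finite), then `F`, read in `R₀⟦T⟧`, has norm profile `D`: coefficients below `D` lie in `pℤ_p` (norm `< 1`), the
`D`-th is a unit (`ℤ_p → R₀` is isometric). [cite: Washington1997, §7.1] -/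
theorem normProfile_map_toUnr_of_order_eq (F : IwasawaAlgebra p) {D : ℕ}
    (hD : (PowerSeries.map (PadicInt.toZMod (p := p)) F).order = D) :
    (∀ i < D, ‖((PowerSeries.coeff i (PowerSeries.map (Halves.toUnr p) F) : unrIntegers p) : ℂ_[p])‖ < 1) ∧
      ‖((PowerSeries.coeff D (PowerSeries.map (Halves.toUnr p) F) : unrIntegers p) : ℂ_[p])‖ = 1 := by
  refine ⟨fun i hi ↦ ?_, ?_⟩
  · rw [PowerSeries.coeff_map, UniversalToricDescentAcDualMuZero.norm_coe_toUnr]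
    have h0 : PowerSeries.coeff i (PowerSeries.map (PadicInt.toZMod (p := p)) F) = 0 :=
      PowerSeries.coeff_of_lt_order i (by rw [hD]; exact_mod_cast hi)
    rw [PowerSeries.coeff_map] at h0
    have hmem : PowerSeries.coeff i F ∈ IsLocalRing.maximalIdeal ℤ_[p] := by
      rw [← PadicInt.ker_toZMod, RingHom.mem_ker]; exact h0
    rw [IsLocalRing.mem_maximalIdeal] at hmem
    exact PadicInt.mem_nonunits.mp hmem
  · rw [← UniversalToricDescentAcDualMuZero.isUnit_coeff_iff_norm_toUnr_eq_one, isUnit_iff_toZMod_ne_zero',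
      ← PowerSeries.coeff_map]
    exact (PowerSeries.order_eq_nat.mp hD).1


end Summit.BirchSwinnertonDyer.BirchSwinnertonDyer.Theorems.UniversalToricDescentNormProfile

end
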